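import Mathlib
import Summits.ValiantsHypothesis.ValiantsHypothesis.Theses.GeneratorObstructions
import Summits.ValiantsHypothesis.ValiantsHypothesis.Theorems.GeneratorObstructionsGenInheritanceUpper

/-!
# Birth skeleton for the piece K2 = `GeneratorObstructions.PowGenDegreeQP` (stmt-ValiantsHypothesis-11655)
# — line `trace-side-regimes` (crux-strategist BC3 skeleton for the split `GenFlipThesis ⇐ K1 ∧ K2`, 2026-08-17)

K2 says: for every `c` there is `c₀` such that inside the window `1 ≤ m ≤ n = m + e ≤ 2^((log₂ m + c)^c)`
every generator type `χ` of `A(Δ_m[tr X_n^m])` has degree `-|χ|/m ≤ 2^((log₂ m + c₀)^c₀)`.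

**Split by the support of the weight** (two regimes with different geometry).  Occurring weights are
entrywise `≤ 0` with support on letters of `MatIdx n`; let `ι : MatIdx m → MatIdx n` be the embedding
of the LAST `m²` letters (strictly monotone onto an upper set).
* `stub_sliceGen` — weights supported on `range ι` (at most `m²` nonzero parts): by inheritance these are
  the generator types of the covariant algebra of the SLICE `Δ(tr X_n^m) ∩ Sym^m ℂ^{m²}` = qp-easy
  `m`-forms in `m²` variables, a `GL_{m²}`-variety in the same ambient space as `Δ(per_m)`.  THIS is the
  half the route's glue consumes (line `slice-overflow` of the parent crux derives `GenFlipThesis` from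
  K1 and this stub alone).
* `stub_wideGen` — weights with a nonzero entry OFF `range ι` (more than `m²` parts: polarisation-heavy
  types, Chow/subspace phenomena in many of the `n²` letters).  Route-irrelevant; kept only because K2 as
  filed quantifies over all weights.  Recommendation to the tenure planner (census §4): restate K2 to the
  slice form, or add `stub_sliceGen` as the crux and demote K2.
`PowGenDegreeQP_of : PowGenDegreeQP` is the case split (sorry-free; window-exponent monotonicity
`logpow_mono` and the identity `χ = ext_ι (χ ∘ ι)` for slice-supported `χ` proved here).
Why each might fail: slice — a super-qp generation degree of `A(Ch_m(ℂ^{m²}))` (`N(T_m)`-invariants of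
the flag algebra of `GL_m`) or of the covariant algebra of another qp-easy family in `m²` variables;
wide — a `U`-invariant Derksen–Makam-type exponential lower bound realised inside `Δ(tr X_n^m)` by forms
using `n^{Ω(1)}` letters (4-tuples of cubics glued into one form, 3-tensors), which the window does not
obviously exclude for polarised weights.
-/

namespace Summit.ValiantsHypothesis.ValiantsHypothesis.Cruxes.GenFlipThesis.TraceSideRegimes

open MvPolynomial
open Literature.NumberTheory.DiophantineGeometry Literature.Computability.AlgebraicComplexity
open Summit.ValiantsHypothesis.ValiantsHypothesis.Theses.GeneratorObstructions
open Summit.ValiantsHypothesis.ValiantsHypothesis.Theorems.GenInheritance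

-- `Summit.ValiantsHypothesis.ValiantsHypothesis.…` is the tree's mandated single-conjunct layout.
set_option linter.dupNamespace false

/-- **stub_sliceGen** (slice regime; identical to stub 2 of line `slice-overflow` of the parent crux):
generator types of `A(Δ_m[tr X_n^m])` supported on the final `m²` letters have quasi-polynomial degree
throughout the window. Conjecture-grade. -/
theorem stub_sliceGen :
    ∀ c : ℕ, ∃ c₀ : ℕ, ∀ m e : ℕ, 1 ≤ m → m + e ≤ 2 ^ ((Nat.log 2 m + c) ^ c) →
      ∀ ι : MatIdx m → MatIdx (m + e), StrictMono ι → IsUpperSet (Set.range ι) →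
        ∀ χ : Weight (MatIdx m),
          Module.finrank ℂ (↥(highestWeightSpace (orbitCoordRep (powFormLex ℂ (m + e) m) m) (Function.extend ι χ 0)) ⧸ Submodule.comap (highestWeightSpace (orbitCoordRep (powFormLex ℂ (m + e) m) m) (Function.extend ι χ 0)).subtype (⨆ p : Weight (MatIdx (m + e)) × Weight (MatIdx (m + e)), ⨆ (_ : p.1 + p.2 = (Function.extend ι χ 0) ∧ p.1 ≠ 0 ∧ p.2 ≠ 0), highestWeightSpace (orbitCoordRep (powFormLex ℂ (m + e) m) m) p.1 * highestWeightSpace (orbitCoordRep (powFormLex ℂ (m + e) m) m) p.2)) ≠ 0 →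
            -(Weight.size χ) ≤ (m : ℤ) * 2 ^ ((Nat.log 2 m + c₀) ^ c₀) := by
  sorry

/-- **stub_wideGen** (wide regime): generator types of `A(Δ_m[tr X_n^m])` with a nonzero entry OFF the
final `m²` letters have quasi-polynomial degree throughout the window. Conjecture-grade; not needed by
the route's glue. -/
theorem stub_wideGen :
    ∀ c : ℕ, ∃ c₀ : ℕ, ∀ m e : ℕ, 1 ≤ m → m + e ≤ 2 ^ ((Nat.log 2 m + c) ^ c) →
      ∀ ι : MatIdx m → MatIdx (m + e), StrictMono ι → IsUpperSet (Set.range ι) →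
        ∀ χ : Weight (MatIdx (m + e)), (∃ x, x ∉ Set.range ι ∧ χ x ≠ 0) →
          Module.finrank ℂ (↥(highestWeightSpace (orbitCoordRep (powFormLex ℂ (m + e) m) m) (χ)) ⧸ Submodule.comap (highestWeightSpace (orbitCoordRep (powFormLex ℂ (m + e) m) m) (χ)).subtype (⨆ p : Weight (MatIdx (m + e)) × Weight (MatIdx (m + e)), ⨆ (_ : p.1 + p.2 = (χ) ∧ p.1 ≠ 0 ∧ p.2 ≠ 0), highestWeightSpace (orbitCoordRep (powFormLex ℂ (m + e) m) m) p.1 * highestWeightSpace (orbitCoordRep (powFormLex ℂ (m + e) m) m) p.2)) ≠ 0 →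
            -(Weight.size χ) ≤ (m : ℤ) * 2 ^ ((Nat.log 2 m + c₀) ^ c₀) := by
  sorry

/-- Window-exponent monotonicity: `(L + c)^c ≤ (L + c')^{c'}` for `c ≤ c'`. [folklore] -/
theorem logpow_mono (L : ℕ) {c c' : ℕ} (h : c ≤ c') : (L + c) ^ c ≤ (L + c') ^ c' := by
  rcases Nat.eq_zero_or_pos (L + c') with h0 | hpos
  · have hc' : c' = 0 := by omega
    have hc : c = 0 := by omega
    subst hc'; subst hc; simp
  · exact (Nat.pow_le_pow_left (by omega) c).trans (Nat.pow_le_pow_right hpos h)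

/-- **K2 from the two stubs**: fix the final-segment embedding `ι`; a weight is either supported on
`range ι` — then it is `ext_ι (χ ∘ ι)` and the slice stub bounds `-|χ ∘ ι| = -|χ|` — or it has a
nonzero entry off `range ι` and the wide stub applies; take `c₀ = max` of the two exponents. -/
theorem PowGenDegreeQP_of : PowGenDegreeQP := by
  intro c
  obtain ⟨c₁, h₁⟩ := stub_sliceGen c
  obtain ⟨c₂, h₂⟩ := stub_wideGen c
  refine ⟨max c₁ c₂, fun m e hm he χ hγ => ?_⟩
  have hκ : Function.Injective fun x : MatIdx m =>
      (toLex (Fin.castAdd e (ofLex x).1, Fin.castAdd e (ofLex x).2) : MatIdx (m + e)) := by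
    intro x y hxy
    have hh := toLex.injective hxy
    rw [Prod.mk.injEq] at hh
    exact ofLex.injective (Prod.ext (Fin.castAdd_injective _ _ hh.1) (Fin.castAdd_injective _ _ hh.2))
  obtain ⟨ι, hι, hup⟩ := exists_strictMono_isUpperSet (σ := MatIdx m) (τ := MatIdx (m + e))
    (Fintype.card_le_of_injective _ hκ)
  have hmono : (2 : ℤ) ^ ((Nat.log 2 m + c₁) ^ c₁) ≤ 2 ^ ((Nat.log 2 m + max c₁ c₂) ^ (max c₁ c₂)) :=
    pow_le_pow_right₀ (by norm_num) (logpow_mono _ (le_max_left _ _))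
  have hmono' : (2 : ℤ) ^ ((Nat.log 2 m + c₂) ^ c₂) ≤ 2 ^ ((Nat.log 2 m + max c₁ c₂) ^ (max c₁ c₂)) :=
    pow_le_pow_right₀ (by norm_num) (logpow_mono _ (le_max_right _ _))
  by_cases hwide : ∃ x, x ∉ Set.range ι ∧ χ x ≠ 0
  · exact (h₂ m e hm he ι hι hup χ hwide hγ).trans (mul_le_mul_of_nonneg_left hmono' (by positivity))
  · push Not at hwide
    have hext : Function.extend ι (χ ∘ ι) 0 = χ := by
      funext x
      by_cases hx : ∃ j, ι j = x
      · obtain ⟨j, rfl⟩ := hx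
        rw [hι.injective.extend_apply, Function.comp_apply]
      · rw [Function.extend_apply' _ _ _ hx, Pi.zero_apply]
        exact (hwide x (fun hmem => hx hmem)).symm
    have hb := h₁ m e hm he ι hι hup (χ ∘ ι) (by rw [hext]; exact hγ)
    have hsize : Weight.size (χ ∘ ι) = Weight.size χ := by
      rw [← size_extend hι.injective (χ ∘ ι), hext]
    rw [hsize] at hb
    exact hb.trans (mul_le_mul_of_nonneg_left hmono (by positivity))

end Summit.ValiantsHypothesis.ValiantsHypothesis.Cruxes.GenFlipThesis.TraceSideRegimes
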